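import Literature.Geometry.Lorentzian.SecondVariationGram
import Literature.Geometry.Lorentzian.RiemannianMeasureComparison
import Literature.Geometry.Lorentzian.VolumeProofs
import Mathlib.Analysis.Calculus.ParametricIntegral
import HarnessLib

/-!
# The first and second variation of area (integrated)

Continuation of `SecondVariationGram.lean` (the pointwise second variation of the area element).
For a smooth one-parameter family `F : ℝ → S → X` of immersions of a surface `S` into a
Riemannian `3`-manifold `(X, h)` (here: smooth on all of `ℝ × S`, every `F t` an immersion — the
case of the composite of a fixed immersion with the flow of a compactly supported vector field),
we study the area `A_K(t) = μ_{F_t^*h}(K)` of a compact set `K ⊆ S`: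

* `SurfaceVariation.density hpb himm t₀ t p` — the density `dμ_t/dμ_{t₀}` of the Riemannian
  measures of the induced metrics, `√det(♯_{t₀} ∘ ♭_t)` (`riemannianMeasure_eq_withDensity_sqrt_det_endo`,
  `RiemannianMeasureComparison.lean`), a smooth function of `(t, p)`; in any basis `β` of `T_p S`
  it is `√(det h(dF_t βᵢ, dF_t βⱼ) / det h(dF_{t₀} βᵢ, dF_{t₀} βⱼ))` (`density_eq_sqrt_div`);
* `SurfaceVariation.areaOn_eq_setIntegral_density` — `μ_t(K) = ∫_K density t₀ t dμ_{t₀}`;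
* `SurfaceVariation.hasDerivAt_areaOn`, `hasDerivAt_setIntegral_densityDeriv` — **differentiation
  under the integral sign** (twice): `A_K'(t) = ∫_K ∂ₜ density`, `(A_K')'(t₀) = ∫_K ∂ₜ² density`
  (dominated convergence on the compact `K`, the `t`-derivatives being jointly continuous);
* `SurfaceVariation.densityDeriv_eq` — **the first variation integrand**:
  `∂ₜ density (t₀, p) = ∑ᵢ h(D_{βᵢ} E, dF βᵢ)` for an `(F_{t₀}^*h)`-orthonormal basis `β` of `T_p S`
  and the variation field `E = ∂ₜF(t₀, ·)` (the tangential divergence of `E`; `= f H` for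
  `E = f ν`);
* `SurfaceVariation.densityDeriv₂_eq` — **the second variation integrand** for a normal
  variation field `E = f ν`:
  `∂ₜ² density (t₀, p) = ‖∇f‖² − f²‖A‖² + f²H² − f² Ric(ν,ν) + ∑ᵢ h(D_{βᵢ} a, dF βᵢ)`,
  `a = D_t ∂ₜF` the acceleration field (`SurfaceVariation.hasDerivAt_det_gram`).

These are the first and second variation formulas of Lawson 1980, Ch. I, Thms. 7.1–7.2 (Simons
1968, §3.2) in the form needed for Schoen–Yau 1979, (2.13): at a minimal immersion which
minimises area under compactly supported deformations, `A_K''(t₀) ≥ 0` and the acceleration term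
is the first variation along another admissible deformation, hence integrates to zero
(`StabilityOfMinimizers.lean`).

Everything is proved; the definitions are `metricAt`, `density`, `densityDeriv`, `densityDeriv₂`,
`areaOn`; no named facts.

## References

* R. Schoen, S.-T. Yau, Comm. Math. Phys. 65 (1979) 45–76, §2, (2.13). [SchoenYauPMT1979]
* H. B. Lawson, *Lectures on minimal submanifolds*, Vol. I, Publish or Perish 1980, Ch. I §7,
  Thms. 7.1–7.2.
* J. Simons, *Minimal varieties in riemannian manifolds*, Ann. of Math. 88 (1968) 62–105, §3.2.
* I. Chavel, *Riemannian Geometry: A Modern Introduction*, 2nd ed., CUP 2006, §III.3.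
-/

noncomputable section

open Bundle Set Manifold TopologicalSpace Filter Function MeasureTheory
open scoped ContDiff Topology Manifold Matrix ENNReal

namespace Literature.Geometry.Lorentzian

open PseudoRiemannianMetric

namespace SurfaceVariation

variable {X : Type*} [TopologicalSpace X] [ChartedSpace E3 X] [IsManifold (𝓡 3) ∞ X]
  {h : ContMDiffRiemannianMetric (𝓡 3) ∞ E3 (TangentSpace (𝓡 3) : X → Type _)}
  [(ofRiemannian h).HasLeviCivita]
  {S : Type*} [TopologicalSpace S] [ChartedSpace (EuclideanSpace ℝ (Fin 2)) S]
  [IsManifold (𝓡 2) ∞ S]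
  {F : ℝ → S → X}

/-! ### The induced metrics of the family and the density `dμ_t / dμ_{t₀}` -/

/-- The induced Riemannian metric `F_t^* h` of the slice `F t` of a family of immersions.
[folklore] -/
abbrev metricAt (hpb : contMDiff_pullbackBilin (𝓡 3) X (𝓡 2) S ∞)
    (himm : ∀ t, (ofRiemannian h).IsSpacelikeImmersion (𝓡 2) (F t)) (t : ℝ) :
    ContMDiffRiemannianMetric (𝓡 2) ∞ (EuclideanSpace ℝ (Fin 2)) (TangentSpace (𝓡 2) : S → Type _) :=
  (ofRiemannian h).inducedRiemannianMetric (F t) hpb (himm t)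

/-- **The density `dμ_t / dμ_{t₀}`** of the Riemannian measure of `F_t^*h` with respect to that of
`F_{t₀}^*h`: `√det T_p` for the endomorphism `T_p = ♯_{F_{t₀}^*h} ∘ ♭_{F_t^*h}` of `T_p S`
(`riemannianMeasure_eq_withDensity_sqrt_det_endo`). Chavel 2006, §III.3, (III.3.5)–(III.3.6).
[cite: Chavel2006, §III.3 (III.3.5)–(III.3.6)] -/
def density (hpb : contMDiff_pullbackBilin (𝓡 3) X (𝓡 2) S ∞)
    (himm : ∀ t, (ofRiemannian h).IsSpacelikeImmersion (𝓡 2) (F t)) (t₀ t : ℝ) (p : S) : ℝ :=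
  Real.sqrt (LinearMap.det
    (((ofRiemannian (metricAt hpb himm t₀)).sharp p).toLinearMap ∘ₗ
      (ofRiemannian (metricAt hpb himm t)).toBilinForm p))

/-- The first time derivative of the density, `∂ₜ (dμ_t/dμ_{t₀})(p)`. [folklore] -/
def densityDeriv (hpb : contMDiff_pullbackBilin (𝓡 3) X (𝓡 2) S ∞)
    (himm : ∀ t, (ofRiemannian h).IsSpacelikeImmersion (𝓡 2) (F t)) (t₀ t : ℝ) (p : S) : ℝ :=
  deriv (fun s ↦ density hpb himm t₀ s p) t

/-- The second time derivative of the density, `∂ₜ² (dμ_t/dμ_{t₀})(p)`. [folklore] -/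
def densityDeriv₂ (hpb : contMDiff_pullbackBilin (𝓡 3) X (𝓡 2) S ∞)
    (himm : ∀ t, (ofRiemannian h).IsSpacelikeImmersion (𝓡 2) (F t)) (t₀ t : ℝ) (p : S) : ℝ :=
  deriv (fun s ↦ densityDeriv hpb himm t₀ s p) t

/-- The area `μ_{F_t^*h}(K)` of a set `K ⊆ S` for the induced metric of the slice `F t`, as a real
number (finite for compact `K`). [folklore] -/
def areaOn [T3Space S] [MeasurableSpace S] [BorelSpace S] (hpb : contMDiff_pullbackBilin (𝓡 3) X (𝓡 2) S ∞)
    (himm : ∀ t, (ofRiemannian h).IsSpacelikeImmersion (𝓡 2) (F t)) (K : Set S) (t : ℝ) : ℝ :=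
  (riemannianMeasure (metricAt hpb himm t) K).toReal

section Basis

variable {hpb : contMDiff_pullbackBilin (𝓡 3) X (𝓡 2) S ∞}
  {himm : ∀ t, (ofRiemannian h).IsSpacelikeImmersion (𝓡 2) (F t)}

omit [(ofRiemannian h).HasLeviCivita] in
/-- **The determinant of `♯₂ ∘ ♭₁` in a basis**: for two metrics on a fibre and any basis `β`,
`det(♯_{g₂} ∘ ♭_{g₁}) · det (g₂(βᵢ, βⱼ)) = det (g₁(βᵢ, βⱼ))` (both Gram matrices are
`BilinForm.toMatrix β`, and `g₁ = g₂ ∘ (T × id)`, `LinearMap.BilinForm.toMatrix_compLeft`).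
[cite: Chavel2006, §III.3 (III.3.5)–(III.3.6)] -/
theorem det_gram_eq_det_endo_mul_det_gram (t₀ t : ℝ) (p : S) {ι : Type*} [Fintype ι]
    [DecidableEq ι] (β : Module.Basis ι ℝ (TangentSpace (𝓡 2) p)) :
    (Matrix.of fun i j ↦ (ofRiemannian h).val (F t p) (mfderiv (𝓡 2) (𝓡 3) (F t) p (β i))
        (mfderiv (𝓡 2) (𝓡 3) (F t) p (β j))).det =
      LinearMap.det (((ofRiemannian (metricAt hpb himm t₀)).sharp p).toLinearMap ∘ₗ
          (ofRiemannian (metricAt hpb himm t)).toBilinForm p) *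
        (Matrix.of fun i j ↦ (ofRiemannian h).val (F t₀ p) (mfderiv (𝓡 2) (𝓡 3) (F t₀) p (β i))
          (mfderiv (𝓡 2) (𝓡 3) (F t₀) p (β j))).det := by
  set g₁ := ofRiemannian (metricAt hpb himm t) with hg₁
  set g₂ := ofRiemannian (metricAt hpb himm t₀) with hg₂
  have hG : ∀ s, (Matrix.of fun i j ↦ (ofRiemannian h).val (F s p)
      (mfderiv (𝓡 2) (𝓡 3) (F s) p (β i)) (mfderiv (𝓡 2) (𝓡 3) (F s) p (β j))) =
      LinearMap.BilinForm.toMatrix β ((ofRiemannian (metricAt hpb himm s)).toBilinForm p) := by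
    intro s
    ext i j
    rw [LinearMap.BilinForm.toMatrix_apply, toBilinForm_apply, Matrix.of_apply]
    rfl
  rw [hG t, hG t₀, toBilinForm_eq_compLeft_sharp_comp (metricAt hpb himm t) (metricAt hpb himm t₀) p,
    LinearMap.BilinForm.toMatrix_compLeft, Matrix.det_mul, Matrix.det_transpose,
    LinearMap.det_toMatrix, ← toBilinForm_eq_compLeft_sharp_comp (metricAt hpb himm t)
      (metricAt hpb himm t₀) p]

omit [(ofRiemannian h).HasLeviCivita] in
/-- The Gram determinant of `dF_t(β)` is positive (the induced form of an immersion is positive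
definite, `det_gram_pos`). [folklore] -/
theorem det_gram_pos' (hpb : contMDiff_pullbackBilin (𝓡 3) X (𝓡 2) S ∞)
    (himm : ∀ t, (ofRiemannian h).IsSpacelikeImmersion (𝓡 2) (F t)) (t : ℝ) (p : S) {ι : Type*}
    [Fintype ι] [DecidableEq ι] (β : Module.Basis ι ℝ (TangentSpace (𝓡 2) p)) :
    0 < (Matrix.of fun i j ↦ (ofRiemannian h).val (F t p) (mfderiv (𝓡 2) (𝓡 3) (F t) p (β i))
        (mfderiv (𝓡 2) (𝓡 3) (F t) p (β j))).det := by
  have := det_gram_pos β (((ofRiemannian h).inducedMetric (F t) hpb (himm t)).toBilinForm p)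
    (fun v w ↦ ((ofRiemannian h).inducedMetric (F t) hpb (himm t)).symm p v w)
    (fun v hv ↦ (himm t).inducedBilin_pos p hv)
  simpa only [toBilinForm_apply, inducedMetric_val, inducedBilin_apply] using this

omit [(ofRiemannian h).HasLeviCivita] in
/-- **The density in a basis**: `dμ_t/dμ_{t₀}(p) = √(det h(dF_t βᵢ, dF_t βⱼ) / det h(dF_{t₀} βᵢ, dF_{t₀} βⱼ))`
for every basis `β` of `T_p S`; in particular `√det h(dF_t βᵢ, dF_t βⱼ)` for an
`(F_{t₀}^*h)`-orthonormal basis (`density_eq_sqrt_of_orthonormal`).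
[cite: Chavel2006, §III.3 (III.3.5)–(III.3.6)] -/
theorem density_eq_sqrt_div (t₀ t : ℝ) (p : S) {ι : Type*} [Fintype ι] [DecidableEq ι]
    (β : Module.Basis ι ℝ (TangentSpace (𝓡 2) p)) :
    density hpb himm t₀ t p =
      Real.sqrt ((Matrix.of fun i j ↦ (ofRiemannian h).val (F t p)
          (mfderiv (𝓡 2) (𝓡 3) (F t) p (β i)) (mfderiv (𝓡 2) (𝓡 3) (F t) p (β j))).det /
        (Matrix.of fun i j ↦ (ofRiemannian h).val (F t₀ p)
          (mfderiv (𝓡 2) (𝓡 3) (F t₀) p (β i)) (mfderiv (𝓡 2) (𝓡 3) (F t₀) p (β j))).det) := by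
  rw [density, det_gram_eq_det_endo_mul_det_gram (hpb := hpb) (himm := himm) t₀ t p β,
    mul_div_cancel_right₀ _ (det_gram_pos' hpb himm t₀ p β).ne']

omit [(ofRiemannian h).HasLeviCivita] in
/-- The density in an `(F_{t₀}^*h)`-orthonormal basis: `dμ_t/dμ_{t₀}(p) = √det h(dF_t βᵢ, dF_t βⱼ)`.
[cite: Chavel2006, §III.3 (III.3.5)–(III.3.6)] -/
theorem density_eq_sqrt_of_orthonormal (t₀ t : ℝ) (p : S)
    (β : Module.Basis (Fin 2) ℝ (TangentSpace (𝓡 2) p))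
    (hβ : ∀ i j, (ofRiemannian h).val (F t₀ p) (mfderiv (𝓡 2) (𝓡 3) (F t₀) p (β i))
      (mfderiv (𝓡 2) (𝓡 3) (F t₀) p (β j)) = if i = j then 1 else 0) :
    density hpb himm t₀ t p =
      Real.sqrt (Matrix.of fun i j ↦ (ofRiemannian h).val (F t p)
          (mfderiv (𝓡 2) (𝓡 3) (F t) p (β i)) (mfderiv (𝓡 2) (𝓡 3) (F t) p (β j))).det := by
  classical
  rw [density_eq_sqrt_div t₀ t p β]
  have h1 : (Matrix.of fun i j ↦ (ofRiemannian h).val (F t₀ p)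
      (mfderiv (𝓡 2) (𝓡 3) (F t₀) p (β i)) (mfderiv (𝓡 2) (𝓡 3) (F t₀) p (β j))).det = 1 := by
    rw [Matrix.det_fin_two]
    simp only [Matrix.of_apply]
    rw [hβ 0 0, hβ 1 1, hβ 0 1, hβ 1 0]
    norm_num
  rw [h1, div_one]

omit [(ofRiemannian h).HasLeviCivita] in
/-- The density is positive. [folklore] -/
theorem density_pos (t₀ t : ℝ) (p : S) : 0 < density hpb himm t₀ t p := by
  classical
  haveI : FiniteDimensional ℝ (TangentSpace (𝓡 2) p) :=
    inferInstanceAs (FiniteDimensional ℝ (EuclideanSpace ℝ (Fin 2)))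
  set β := Module.finBasis ℝ (TangentSpace (𝓡 2) p)
  rw [density_eq_sqrt_div t₀ t p β]
  exact Real.sqrt_pos.2 (div_pos (det_gram_pos' hpb himm t p β) (det_gram_pos' hpb himm t₀ p β))

omit [(ofRiemannian h).HasLeviCivita] in
/-- At `t = t₀` the density is `1`. [folklore] -/
theorem density_self (t₀ : ℝ) (p : S) : density hpb himm t₀ t₀ p = 1 := by
  classical
  haveI : FiniteDimensional ℝ (TangentSpace (𝓡 2) p) :=
    inferInstanceAs (FiniteDimensional ℝ (EuclideanSpace ℝ (Fin 2)))
  set β := Module.finBasis ℝ (TangentSpace (𝓡 2) p)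
  rw [density_eq_sqrt_div t₀ t₀ p β, div_self (det_gram_pos' hpb himm t₀ p β).ne', Real.sqrt_one]

end Basis

/-! ### The area of a set as an integral of the density -/

section Area

variable [T3Space S] [SecondCountableTopology S] [MeasurableSpace S] [BorelSpace S]
  {hpb : contMDiff_pullbackBilin (𝓡 3) X (𝓡 2) S ∞}
  {himm : ∀ t, (ofRiemannian h).IsSpacelikeImmersion (𝓡 2) (F t)}

omit [(ofRiemannian h).HasLeviCivita] in
/-- **`dμ_t = (dμ_t/dμ_{t₀}) dμ_{t₀}`** for the induced metrics of the family
(`riemannianMeasure_eq_withDensity_sqrt_det_endo`). [cite: Chavel2006, §III.3 (III.3.5)–(III.3.6)] -/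
theorem riemannianMeasure_eq_withDensity_density (t₀ t : ℝ) :
    riemannianMeasure (metricAt hpb himm t) =
      (riemannianMeasure (metricAt hpb himm t₀)).withDensity
        fun p ↦ ENNReal.ofReal (density hpb himm t₀ t p) :=
  riemannianMeasure_eq_withDensity_sqrt_det_endo (metricAt hpb himm t) (metricAt hpb himm t₀)

omit [(ofRiemannian h).HasLeviCivita] [T3Space S] [SecondCountableTopology S] [MeasurableSpace S]
  [BorelSpace S] in
/-- The density is continuous on `S` (for fixed times). [folklore] -/
theorem continuous_density (t₀ t : ℝ) : Continuous fun p ↦ density hpb himm t₀ t p :=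
  continuous_sqrt_det_endo (metricAt hpb himm t) (metricAt hpb himm t₀)

omit [(ofRiemannian h).HasLeviCivita] [SecondCountableTopology S] in
/-- Compact sets have finite area for every slice. [cite: Federer1969, §3.2.46] -/
theorem riemannianMeasure_lt_top_of_isCompact (t : ℝ) {K : Set S} (hK : IsCompact K) :
    riemannianMeasure (metricAt hpb himm t) K < ⊤ :=
  riemannianVolume_lt_top_of_isCompact_holds (metricAt hpb himm t) le_rfl hK

omit [(ofRiemannian h).HasLeviCivita] in
/-- **The area as an integral of the density**: for a compact `K`,
`μ_t(K) = ∫_K (dμ_t/dμ_{t₀}) dμ_{t₀}` (as real numbers). [cite: Chavel2006, §III.3 (III.3.5)–(III.3.6)] -/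
theorem areaOn_eq_setIntegral_density (t₀ t : ℝ) {K : Set S} (hK : IsCompact K) :
    areaOn hpb himm K t = ∫ p in K, density hpb himm t₀ t p ∂riemannianMeasure (metricAt hpb himm t₀) := by
  have hKm : MeasurableSet K := hK.measurableSet
  rw [areaOn, riemannianMeasure_eq_withDensity_density t₀ t, withDensity_apply _ hKm]
  rw [integral_eq_lintegral_of_nonneg_ae (ae_of_all _ fun p ↦ (density_pos t₀ t p).le)
    ((continuous_density t₀ t).aestronglyMeasurable)]

end Area


/-! ### Smoothness of the density in `(t, p)`: chart representation -/

section Chart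

variable {hpb : contMDiff_pullbackBilin (𝓡 3) X (𝓡 2) S ∞}
  {himm : ∀ t, (ofRiemannian h).IsSpacelikeImmersion (𝓡 2) (F t)}

omit [(ofRiemannian h).HasLeviCivita] [IsManifold (𝓡 3) ∞ X] in
/-- The globally smooth family read in a chart of `S`: `(t, u) ↦ F t (φ⁻¹ u)` is `C^∞` on
`ℝ × φ.target`. [folklore] -/
theorem contMDiffOn_chartFamily_univ
    (hF : ContMDiff (𝓘(ℝ, ℝ).prod (𝓡 2)) (𝓡 3) ∞ (fun q : ℝ × S ↦ F q.1 q.2)) (y₀ : S) :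
    ContMDiffOn 𝓘(ℝ, ℝ × EuclideanSpace ℝ (Fin 2)) (𝓡 3) ∞
      (fun q : ℝ × EuclideanSpace ℝ (Fin 2) ↦ F q.1 ((extChartAt (𝓡 2) y₀).symm q.2))
      (univ ×ˢ (extChartAt (𝓡 2) y₀).target) := by
  have hG : ContMDiffOn (𝓘(ℝ, ℝ).prod 𝓘(ℝ, EuclideanSpace ℝ (Fin 2))) (𝓘(ℝ, ℝ).prod (𝓡 2)) ∞
      (fun q : ℝ × EuclideanSpace ℝ (Fin 2) ↦ ((q.1, (extChartAt (𝓡 2) y₀).symm q.2) : ℝ × S))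
      (univ ×ˢ (extChartAt (𝓡 2) y₀).target) :=
    contMDiffOn_fst.prodMk ((contMDiffOn_extChartAt_symm y₀).comp contMDiffOn_snd
      fun q hq ↦ hq.2)
  have h1 : ContMDiffOn (𝓘(ℝ, ℝ).prod 𝓘(ℝ, EuclideanSpace ℝ (Fin 2))) (𝓡 3) ∞
      (fun q : ℝ × EuclideanSpace ℝ (Fin 2) ↦ F q.1 ((extChartAt (𝓡 2) y₀).symm q.2))
      (univ ×ˢ (extChartAt (𝓡 2) y₀).target) := hF.comp_contMDiffOn hG
  rw [modelWithCornersSelf_prod, ← chartedSpaceSelf_prod]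
  exact h1

omit [(ofRiemannian h).HasLeviCivita] in
/-- **The chart Gram matrix of the induced metrics is jointly smooth**: each entry
`(t, u) ↦ (F_t^*h)_{ij}(u) = h(dF_t ∂ᵢ, dF_t ∂ⱼ)(φ⁻¹ u)` of `chartGramMatrix (F_t^*h) y₀ u` is `C^∞`
on `ℝ × φ.target` (`= h(dP(0,eᵢ), dP(0,eⱼ))` for the chart family `P`, `contMDiffAt_val_apply_along`
with `contMDiffAt_lift_mfderiv_const`). [folklore] -/
theorem contDiffOn_chartGramMatrix_entry
    (hF : ContMDiff (𝓘(ℝ, ℝ).prod (𝓡 2)) (𝓡 3) ∞ (fun q : ℝ × S ↦ F q.1 q.2)) (y₀ : S)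
    (i j : Fin 2) :
    ContDiffOn ℝ ∞ (fun q : ℝ × EuclideanSpace ℝ (Fin 2) ↦
        chartGramMatrix (metricAt hpb himm q.1) y₀ q.2 i j)
      (univ ×ˢ (extChartAt (𝓡 2) y₀).target) := by
  set b := (EuclideanSpace.basisFun (Fin 2) ℝ).toBasis with hb
  set D : Set (ℝ × EuclideanSpace ℝ (Fin 2)) := univ ×ˢ (extChartAt (𝓡 2) y₀).target with hD
  have hDo : IsOpen D := isOpen_univ.prod (isOpen_extChartAt_target y₀)
  have hP := contMDiffOn_chartFamily_univ hF y₀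
  -- the smooth function `q ↦ h(dP_q(0, eᵢ), dP_q(0, eⱼ))`
  have hsmooth : ∀ q ∈ D, ContMDiffAt 𝓘(ℝ, ℝ × EuclideanSpace ℝ (Fin 2)) 𝓘(ℝ, ℝ) ∞
      (fun q' : ℝ × EuclideanSpace ℝ (Fin 2) ↦ (ofRiemannian h).val
        (F q'.1 ((extChartAt (𝓡 2) y₀).symm q'.2))
        (mfderiv 𝓘(ℝ, ℝ × EuclideanSpace ℝ (Fin 2)) (𝓡 3)
          (fun q : ℝ × EuclideanSpace ℝ (Fin 2) ↦ F q.1 ((extChartAt (𝓡 2) y₀).symm q.2)) q'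
          ((0 : ℝ), b i))
        (mfderiv 𝓘(ℝ, ℝ × EuclideanSpace ℝ (Fin 2)) (𝓡 3)
          (fun q : ℝ × EuclideanSpace ℝ (Fin 2) ↦ F q.1 ((extChartAt (𝓡 2) y₀).symm q.2)) q'
          ((0 : ℝ), b j))) q := fun q hq ↦
    contMDiffAt_val_apply_along (ofRiemannian h) le_rfl
      (contMDiffAt_lift_mfderiv_const hDo hP hq _) (contMDiffAt_lift_mfderiv_const hDo hP hq _)
  -- which agrees with the Gram entry on `D`
  have heq : ∀ q ∈ D, chartGramMatrix (metricAt hpb himm q.1) y₀ q.2 i j =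
      (ofRiemannian h).val (F q.1 ((extChartAt (𝓡 2) y₀).symm q.2))
        (mfderiv 𝓘(ℝ, ℝ × EuclideanSpace ℝ (Fin 2)) (𝓡 3)
          (fun q : ℝ × EuclideanSpace ℝ (Fin 2) ↦ F q.1 ((extChartAt (𝓡 2) y₀).symm q.2)) q
          ((0 : ℝ), b i))
        (mfderiv 𝓘(ℝ, ℝ × EuclideanSpace ℝ (Fin 2)) (𝓡 3)
          (fun q : ℝ × EuclideanSpace ℝ (Fin 2) ↦ F q.1 ((extChartAt (𝓡 2) y₀).symm q.2)) q
          ((0 : ℝ), b j)) := by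
    rintro ⟨t, u⟩ hq
    have hu : u ∈ (extChartAt (𝓡 2) y₀).target := hq.2
    have hFt : MDifferentiableAt (𝓡 2) (𝓡 3) (F t) ((extChartAt (𝓡 2) y₀).symm u) :=
      ((himm t).contMDiff_self _).mdifferentiableAt (by simp)
    have hPd : MDifferentiableAt 𝓘(ℝ, ℝ × EuclideanSpace ℝ (Fin 2)) (𝓡 3)
        (fun q : ℝ × EuclideanSpace ℝ (Fin 2) ↦ F q.1 ((extChartAt (𝓡 2) y₀).symm q.2)) (t, u) :=
      (hP.contMDiffAt (hDo.mem_nhds hq)).mdifferentiableAt (by simp)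
    dsimp only
    rw [chartGramMatrix_apply_eq_val_localFrame (metricAt hpb himm t) y₀ hu i j]
    change (ofRiemannian h).val (F t ((extChartAt (𝓡 2) y₀).symm u))
      (mfderiv (𝓡 2) (𝓡 3) (F t) ((extChartAt (𝓡 2) y₀).symm u) _)
      (mfderiv (𝓡 2) (𝓡 3) (F t) ((extChartAt (𝓡 2) y₀).symm u) _) = _
    rw [IsClassicalIMCF.mfderiv_localFrame_eq_mfderiv_chartFlow b hu hFt hPd i,
      IsClassicalIMCF.mfderiv_localFrame_eq_mfderiv_chartFlow b hu hFt hPd j]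
  intro q hq
  have h1 := (contMDiffAt_iff_contDiffAt.1 (hsmooth q hq)).contDiffWithinAt (s := D)
  exact h1.congr (fun q' hq' ↦ heq q' hq') (heq q hq)

omit [(ofRiemannian h).HasLeviCivita] in
/-- **Chart representation of the density**: on the target of the chart `φ` of `S` at `y₀` there
is a `C^∞` function `R` on `ℝ × φ.target` with `dμ_t/dμ_{t₀}(φ⁻¹ u) = R(t, u)`, namely
`R = √(det (F_t^*h)_{ij} / det (F_{t₀}^*h)_{ij})` (`det_chartGramMatrix_eq_det_endo_mul`; the chart
Gram determinants are positive and jointly smooth). [cite: Chavel2006, §III.3 (III.3.5)–(III.3.6)] -/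
theorem exists_contDiffOn_density_chart
    (hF : ContMDiff (𝓘(ℝ, ℝ).prod (𝓡 2)) (𝓡 3) ∞ (fun q : ℝ × S ↦ F q.1 q.2)) (t₀ : ℝ)
    (y₀ : S) :
    ∃ R : ℝ × EuclideanSpace ℝ (Fin 2) → ℝ,
      ContDiffOn ℝ ∞ R (univ ×ˢ (extChartAt (𝓡 2) y₀).target) ∧
      ∀ (t : ℝ), ∀ u ∈ (extChartAt (𝓡 2) y₀).target,
        density hpb himm t₀ t ((extChartAt (𝓡 2) y₀).symm u) = R (t, u) := by
  set D : Set (ℝ × EuclideanSpace ℝ (Fin 2)) := univ ×ˢ (extChartAt (𝓡 2) y₀).target with hD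
  -- the chart Gram determinants
  set Dc : ℝ × EuclideanSpace ℝ (Fin 2) → ℝ := fun q ↦
    (chartGramMatrix (metricAt hpb himm q.1) y₀ q.2).det with hDc
  have hDc_smooth : ContDiffOn ℝ ∞ Dc D := by
    have h2 : Dc = fun q ↦ chartGramMatrix (metricAt hpb himm q.1) y₀ q.2 0 0 *
        chartGramMatrix (metricAt hpb himm q.1) y₀ q.2 1 1 -
        chartGramMatrix (metricAt hpb himm q.1) y₀ q.2 0 1 *
          chartGramMatrix (metricAt hpb himm q.1) y₀ q.2 1 0 := by
      funext q; simp [hDc, Matrix.det_fin_two]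
    rw [h2]
    exact ((contDiffOn_chartGramMatrix_entry hF y₀ 0 0).mul
      (contDiffOn_chartGramMatrix_entry hF y₀ 1 1)).sub
      ((contDiffOn_chartGramMatrix_entry hF y₀ 0 1).mul
        (contDiffOn_chartGramMatrix_entry hF y₀ 1 0))
  have hDc_pos : ∀ q ∈ D, 0 < Dc q := fun q hq ↦
    Real.sqrt_pos.1 (sqrt_det_chartGramMatrix_pos (metricAt hpb himm q.1) y₀ hq.2)
  have hDc0_smooth : ContDiffOn ℝ ∞ (fun q : ℝ × EuclideanSpace ℝ (Fin 2) ↦ Dc (t₀, q.2)) D :=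
    hDc_smooth.comp (contDiffOn_const.prodMk contDiffOn_snd) fun q hq ↦ ⟨mem_univ _, hq.2⟩
  have hDc0_ne : ∀ q ∈ D, Dc (t₀, q.2) ≠ 0 := fun q hq ↦
    (hDc_pos (t₀, q.2) ⟨mem_univ _, hq.2⟩).ne'
  refine ⟨fun q ↦ Real.sqrt (Dc q / Dc (t₀, q.2)), ?_, fun t u hu ↦ ?_⟩
  · refine ContDiffOn.sqrt (hDc_smooth.div hDc0_smooth hDc0_ne) fun q hq ↦ ?_
    exact (div_pos (hDc_pos q hq) (hDc_pos (t₀, q.2) ⟨mem_univ _, hq.2⟩)).ne'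
  · have hDcq : Dc (t, u) = LinearMap.det (((ofRiemannian (metricAt hpb himm t₀)).sharp
        ((extChartAt (𝓡 2) y₀).symm u)).toLinearMap ∘ₗ
          (ofRiemannian (metricAt hpb himm t)).toBilinForm ((extChartAt (𝓡 2) y₀).symm u)) *
        Dc (t₀, u) :=
      det_chartGramMatrix_eq_det_endo_mul (metricAt hpb himm t) (metricAt hpb himm t₀) y₀ hu
    dsimp only
    rw [density, hDcq, mul_div_cancel_right₀ _ (hDc0_ne (t, u) ⟨mem_univ _, hu⟩)]

/-- From a `C^∞` chart representation `R` on the open set `U = ℝ × φ.target`: the partial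
derivative `R₁ = ∂ₜR = dR(1, 0)` is again `C^∞` on `U`, and `t ↦ R(t, u)` has derivative `R₁(t, u)`.
[folklore] -/
theorem contDiffOn_tderiv {R : ℝ × EuclideanSpace ℝ (Fin 2) → ℝ} {U : Set (EuclideanSpace ℝ (Fin 2))}
    (hU : IsOpen U) (hR : ContDiffOn ℝ ∞ R (univ ×ˢ U)) :
    ContDiffOn ℝ ∞ (fun q ↦ fderiv ℝ R q ((1 : ℝ), (0 : EuclideanSpace ℝ (Fin 2)))) (univ ×ˢ U) ∧
      ∀ (t : ℝ), ∀ u ∈ U, HasDerivAt (fun s ↦ R (s, u))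
        (fderiv ℝ R (t, u) ((1 : ℝ), (0 : EuclideanSpace ℝ (Fin 2)))) t := by
  have hUo : IsOpen (univ ×ˢ U : Set (ℝ × EuclideanSpace ℝ (Fin 2))) := isOpen_univ.prod hU
  refine ⟨(hR.fderiv_of_isOpen hUo le_rfl).clm_apply contDiffOn_const, fun t u hu ↦ ?_⟩
  have hq : ((t, u) : ℝ × EuclideanSpace ℝ (Fin 2)) ∈ univ ×ˢ U := ⟨mem_univ _, hu⟩
  have hd : HasFDerivAt R (fderiv ℝ R (t, u)) (t, u) :=
    ((hR.contDiffAt (hUo.mem_nhds hq)).differentiableAt (by simp)).hasFDerivAt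
  have hl : HasDerivAt (fun s : ℝ ↦ ((s, u) : ℝ × EuclideanSpace ℝ (Fin 2)))
      ((1 : ℝ), (0 : EuclideanSpace ℝ (Fin 2))) t := by
    simpa using (hasDerivAt_id t).prodMk (hasDerivAt_const t u)
  exact hd.comp_hasDerivAt t hl

omit [(ofRiemannian h).HasLeviCivita] in
/-- **Chart representation of the density and of its first two time derivatives.** On the chart
of `S` at `y₀` there are `C^∞` functions `R, R₁, R₂` on `ℝ × φ.target` representing `dμ_t/dμ_{t₀}`,
`∂ₜ(dμ_t/dμ_{t₀})` and `∂ₜ²(dμ_t/dμ_{t₀})` at `φ⁻¹ u`, with `∂ₜR = R₁`, `∂ₜR₁ = R₂`. [folklore] -/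
theorem exists_chart_density_derivs
    (hF : ContMDiff (𝓘(ℝ, ℝ).prod (𝓡 2)) (𝓡 3) ∞ (fun q : ℝ × S ↦ F q.1 q.2)) (t₀ : ℝ)
    (y₀ : S) :
    ∃ R R₁ R₂ : ℝ × EuclideanSpace ℝ (Fin 2) → ℝ,
      ContDiffOn ℝ ∞ R (univ ×ˢ (extChartAt (𝓡 2) y₀).target) ∧
      ContDiffOn ℝ ∞ R₁ (univ ×ˢ (extChartAt (𝓡 2) y₀).target) ∧
      ContDiffOn ℝ ∞ R₂ (univ ×ˢ (extChartAt (𝓡 2) y₀).target) ∧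
      (∀ (t : ℝ), ∀ u ∈ (extChartAt (𝓡 2) y₀).target,
        density hpb himm t₀ t ((extChartAt (𝓡 2) y₀).symm u) = R (t, u)) ∧
      (∀ (t : ℝ), ∀ u ∈ (extChartAt (𝓡 2) y₀).target,
        HasDerivAt (fun s ↦ density hpb himm t₀ s ((extChartAt (𝓡 2) y₀).symm u)) (R₁ (t, u)) t ∧
        densityDeriv hpb himm t₀ t ((extChartAt (𝓡 2) y₀).symm u) = R₁ (t, u)) ∧
      (∀ (t : ℝ), ∀ u ∈ (extChartAt (𝓡 2) y₀).target,
        HasDerivAt (fun s ↦ densityDeriv hpb himm t₀ s ((extChartAt (𝓡 2) y₀).symm u)) (R₂ (t, u)) t ∧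
        densityDeriv₂ hpb himm t₀ t ((extChartAt (𝓡 2) y₀).symm u) = R₂ (t, u)) := by
  obtain ⟨R, hR, hRd⟩ := exists_contDiffOn_density_chart (hpb := hpb) (himm := himm) hF t₀ y₀
  have hU : IsOpen (extChartAt (𝓡 2) y₀).target := isOpen_extChartAt_target y₀
  obtain ⟨hR₁, hR₁d⟩ := contDiffOn_tderiv hU hR
  set R₁ : ℝ × EuclideanSpace ℝ (Fin 2) → ℝ := fun q ↦ fderiv ℝ R q
    ((1 : ℝ), (0 : EuclideanSpace ℝ (Fin 2))) with hR₁def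
  obtain ⟨hR₂, hR₂d⟩ := contDiffOn_tderiv hU hR₁
  set R₂ : ℝ × EuclideanSpace ℝ (Fin 2) → ℝ := fun q ↦ fderiv ℝ R₁ q
    ((1 : ℝ), (0 : EuclideanSpace ℝ (Fin 2))) with hR₂def
  -- the density along a chart point is `R(·, u)`
  have hfun : ∀ u ∈ (extChartAt (𝓡 2) y₀).target,
      (fun s ↦ density hpb himm t₀ s ((extChartAt (𝓡 2) y₀).symm u)) = fun s ↦ R (s, u) :=
    fun u hu ↦ funext fun s ↦ hRd s u hu
  have h1 : ∀ (t : ℝ), ∀ u ∈ (extChartAt (𝓡 2) y₀).target,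
      HasDerivAt (fun s ↦ density hpb himm t₀ s ((extChartAt (𝓡 2) y₀).symm u)) (R₁ (t, u)) t ∧
      densityDeriv hpb himm t₀ t ((extChartAt (𝓡 2) y₀).symm u) = R₁ (t, u) := by
    intro t u hu
    have hd : HasDerivAt (fun s ↦ density hpb himm t₀ s ((extChartAt (𝓡 2) y₀).symm u))
        (R₁ (t, u)) t := by
      rw [hfun u hu]; exact hR₁d t u hu
    exact ⟨hd, hd.deriv⟩
  have hfun₁ : ∀ u ∈ (extChartAt (𝓡 2) y₀).target,
      (fun s ↦ densityDeriv hpb himm t₀ s ((extChartAt (𝓡 2) y₀).symm u)) = fun s ↦ R₁ (s, u) :=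
    fun u hu ↦ funext fun s ↦ (h1 s u hu).2
  have h2 : ∀ (t : ℝ), ∀ u ∈ (extChartAt (𝓡 2) y₀).target,
      HasDerivAt (fun s ↦ densityDeriv hpb himm t₀ s ((extChartAt (𝓡 2) y₀).symm u)) (R₂ (t, u)) t ∧
      densityDeriv₂ hpb himm t₀ t ((extChartAt (𝓡 2) y₀).symm u) = R₂ (t, u) := by
    intro t u hu
    have hd : HasDerivAt (fun s ↦ densityDeriv hpb himm t₀ s ((extChartAt (𝓡 2) y₀).symm u))
        (R₂ (t, u)) t := by
      rw [hfun₁ u hu]; exact hR₂d t u hu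
    exact ⟨hd, hd.deriv⟩
  exact ⟨R, R₁, R₂, hR, hR₁, hR₂, hRd, h1, h2⟩

omit [(ofRiemannian h).HasLeviCivita] in
/-- **The density is twice differentiable in time, everywhere**: `∂ₜ(dμ_t/dμ_{t₀})(p)` exists with
value `densityDeriv`, and `∂ₜ densityDeriv` exists with value `densityDeriv₂`. [folklore] -/
theorem hasDerivAt_density
    (hF : ContMDiff (𝓘(ℝ, ℝ).prod (𝓡 2)) (𝓡 3) ∞ (fun q : ℝ × S ↦ F q.1 q.2)) (t₀ t : ℝ) (p : S) :
    HasDerivAt (fun s ↦ density hpb himm t₀ s p) (densityDeriv hpb himm t₀ t p) t ∧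
      HasDerivAt (fun s ↦ densityDeriv hpb himm t₀ s p) (densityDeriv₂ hpb himm t₀ t p) t := by
  obtain ⟨R, R₁, R₂, -, -, -, -, h1, h2⟩ :=
    exists_chart_density_derivs (hpb := hpb) (himm := himm) hF t₀ p
  have hu : extChartAt (𝓡 2) p p ∈ (extChartAt (𝓡 2) p).target := mem_extChartAt_target p
  have hp : (extChartAt (𝓡 2) p).symm (extChartAt (𝓡 2) p p) = p := extChartAt_to_inv p
  obtain ⟨h1a, h1b⟩ := h1 t _ hu
  obtain ⟨h2a, h2b⟩ := h2 t _ hu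
  rw [hp] at h1a h1b h2a h2b
  exact ⟨h1b ▸ h1a, h2b ▸ h2a⟩

omit [(ofRiemannian h).HasLeviCivita] in
/-- **The time derivatives of the density are jointly continuous in `(t, p)`** (locally they
are chart representations `R₁(t, φ p)`, `R₂(t, φ p)` of class `C^∞`). [folklore] -/
theorem continuous_densityDeriv
    (hF : ContMDiff (𝓘(ℝ, ℝ).prod (𝓡 2)) (𝓡 3) ∞ (fun q : ℝ × S ↦ F q.1 q.2)) (t₀ : ℝ) :
    Continuous (fun q : ℝ × S ↦ densityDeriv hpb himm t₀ q.1 q.2) ∧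
      Continuous (fun q : ℝ × S ↦ densityDeriv₂ hpb himm t₀ q.1 q.2) := by
  have key : ∀ q₀ : ℝ × S,
      ContinuousAt (fun q : ℝ × S ↦ densityDeriv hpb himm t₀ q.1 q.2) q₀ ∧
      ContinuousAt (fun q : ℝ × S ↦ densityDeriv₂ hpb himm t₀ q.1 q.2) q₀ := by
    rintro ⟨t, p⟩
    obtain ⟨R, R₁, R₂, -, hR₁, hR₂, -, h1, h2⟩ :=
      exists_chart_density_derivs (hpb := hpb) (himm := himm) hF t₀ p
    have hUo : IsOpen (univ ×ˢ (extChartAt (𝓡 2) p).target : Set (ℝ × EuclideanSpace ℝ (Fin 2))) :=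
      isOpen_univ.prod (isOpen_extChartAt_target p)
    -- `q ↦ (q.1, φ q.2)` is continuous at `(t, p)` and maps a neighbourhood into the chart image
    have hψ : ContinuousAt (fun q : ℝ × S ↦ ((q.1, extChartAt (𝓡 2) p q.2) :
        ℝ × EuclideanSpace ℝ (Fin 2))) (t, p) :=
      continuousAt_fst.prodMk (ContinuousAt.comp (f := fun q : ℝ × S ↦ q.2) (x := (t, p))
        (continuousAt_extChartAt p) continuousAt_snd)
    have hmem : ((t, extChartAt (𝓡 2) p p) : ℝ × EuclideanSpace ℝ (Fin 2)) ∈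
        univ ×ˢ (extChartAt (𝓡 2) p).target := ⟨mem_univ _, mem_extChartAt_target p⟩
    have hev : ∀ᶠ q : ℝ × S in 𝓝 (t, p), q.2 ∈ (extChartAt (𝓡 2) p).source :=
      continuousAt_snd.preimage_mem_nhds (extChartAt_source_mem_nhds p)
    have heq₁ : (fun q : ℝ × S ↦ densityDeriv hpb himm t₀ q.1 q.2) =ᶠ[𝓝 (t, p)]
        fun q ↦ R₁ (q.1, extChartAt (𝓡 2) p q.2) := by
      filter_upwards [hev] with q hq
      have h := (h1 q.1 _ ((extChartAt (𝓡 2) p).map_source hq)).2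
      rwa [(extChartAt (𝓡 2) p).left_inv hq] at h
    have heq₂ : (fun q : ℝ × S ↦ densityDeriv₂ hpb himm t₀ q.1 q.2) =ᶠ[𝓝 (t, p)]
        fun q ↦ R₂ (q.1, extChartAt (𝓡 2) p q.2) := by
      filter_upwards [hev] with q hq
      have h := (h2 q.1 _ ((extChartAt (𝓡 2) p).map_source hq)).2
      rwa [(extChartAt (𝓡 2) p).left_inv hq] at h
    refine ⟨?_, ?_⟩
    · refine (ContinuousAt.congr ?_ heq₁.symm)
      exact ContinuousAt.comp (f := fun q : ℝ × S ↦ ((q.1, extChartAt (𝓡 2) p q.2) :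
        ℝ × EuclideanSpace ℝ (Fin 2))) (x := (t, p))
        (hR₁.continuousOn.continuousAt (hUo.mem_nhds hmem)) hψ
    · refine (ContinuousAt.congr ?_ heq₂.symm)
      exact ContinuousAt.comp (f := fun q : ℝ × S ↦ ((q.1, extChartAt (𝓡 2) p q.2) :
        ℝ × EuclideanSpace ℝ (Fin 2))) (x := (t, p))
        (hR₂.continuousOn.continuousAt (hUo.mem_nhds hmem)) hψ
  exact ⟨continuous_iff_continuousAt.2 fun q ↦ (key q).1,
    continuous_iff_continuousAt.2 fun q ↦ (key q).2⟩

end Chart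

/-! ### Differentiation of the area under the integral sign -/

section Deriv

variable [T3Space S] [SecondCountableTopology S] [MeasurableSpace S] [BorelSpace S]
  {hpb : contMDiff_pullbackBilin (𝓡 3) X (𝓡 2) S ∞}
  {himm : ∀ t, (ofRiemannian h).IsSpacelikeImmersion (𝓡 2) (F t)}

omit [(ofRiemannian h).HasLeviCivita] [ChartedSpace (EuclideanSpace ℝ (Fin 2)) S] [IsManifold (𝓡 2) ∞ S]
  [T3Space S] [SecondCountableTopology S] [MeasurableSpace S] [BorelSpace S] in
/-- A jointly continuous function `G : ℝ × S → ℝ` is bounded on `[t-1, t+1] × K` for compact `K`.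
[folklore] -/
theorem exists_bound_of_continuous {G : ℝ × S → ℝ} (hG : Continuous G) (t : ℝ) {K : Set S}
    (hK : IsCompact K) :
    ∃ C : ℝ, ∀ s ∈ Metric.ball t 1, ∀ p ∈ K, ‖G (s, p)‖ ≤ C := by
  obtain ⟨C, hC⟩ := (isCompact_Icc.prod hK).exists_bound_of_continuousOn
    (s := (Icc (t - 1) (t + 1)) ×ˢ K) hG.continuousOn
  refine ⟨C, fun s hs p hp ↦ hC (s, p) ⟨?_, hp⟩⟩
  rw [Metric.mem_ball, Real.dist_eq] at hs
  constructor <;> linarith [(abs_lt.1 hs).1, (abs_lt.1 hs).2]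

omit [(ofRiemannian h).HasLeviCivita] in
/-- **First variation of area, differentiated under the integral sign**: for a compact `K ⊆ S`
and every time `t`, `A_K(s) = μ_s(K)` is differentiable at `t` with
`A_K'(t) = ∫_K ∂ₜ(dμ_t/dμ_{t₀}) dμ_{t₀}` (dominated convergence: the integrand of
`A_K(s) = ∫_K dμ_s/dμ_{t₀} dμ_{t₀}` has a jointly continuous, hence locally bounded, time
derivative, and `μ_{t₀}(K) < ∞`). Lawson 1980, Ch. I, Thm. 7.1 ("differentiating under the
integral sign"). [cite: Chavel2006, §III.3 (III.3.5)–(III.3.6)] -/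
theorem hasDerivAt_areaOn
    (hF : ContMDiff (𝓘(ℝ, ℝ).prod (𝓡 2)) (𝓡 3) ∞ (fun q : ℝ × S ↦ F q.1 q.2)) (t₀ : ℝ)
    {K : Set S} (hK : IsCompact K) (t : ℝ) :
    Integrable (fun p ↦ densityDeriv hpb himm t₀ t p)
        ((riemannianMeasure (metricAt hpb himm t₀)).restrict K) ∧
      HasDerivAt (areaOn hpb himm K)
        (∫ p in K, densityDeriv hpb himm t₀ t p ∂riemannianMeasure (metricAt hpb himm t₀)) t := by
  set μ₀ := riemannianMeasure (metricAt hpb himm t₀) with hμ₀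
  haveI : IsFiniteMeasure (μ₀.restrict K) := by
    refine ⟨?_⟩
    rw [Measure.restrict_apply_univ]
    exact riemannianMeasure_lt_top_of_isCompact t₀ hK
  obtain ⟨hc₁, -⟩ := continuous_densityDeriv (hpb := hpb) (himm := himm) hF t₀
  obtain ⟨C, hC⟩ := exists_bound_of_continuous hc₁ t hK
  have hmeas : ∀ s, AEStronglyMeasurable (fun p ↦ density hpb himm t₀ s p) (μ₀.restrict K) :=
    fun s ↦ (continuous_density t₀ s).aestronglyMeasurable
  have hmeas₁ : ∀ s, AEStronglyMeasurable (fun p ↦ densityDeriv hpb himm t₀ s p) (μ₀.restrict K) :=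
    fun s ↦ (hc₁.comp (continuous_const.prodMk continuous_id)).aestronglyMeasurable
  have hint : Integrable (fun p ↦ density hpb himm t₀ t p) (μ₀.restrict K) := by
    obtain ⟨C', hC'⟩ := hK.exists_bound_of_continuousOn (continuous_density (hpb := hpb)
      (himm := himm) t₀ t).continuousOn
    exact Integrable.of_bound (hmeas t) C' ((ae_restrict_iff' hK.measurableSet).2
      (ae_of_all _ fun p hp ↦ hC' p hp))
  have key := hasDerivAt_integral_of_dominated_loc_of_deriv_le (μ := μ₀.restrict K)
    (F := fun s p ↦ density hpb himm t₀ s p) (F' := fun s p ↦ densityDeriv hpb himm t₀ s p)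
    (x₀ := t) (bound := fun _ ↦ C) (Metric.ball_mem_nhds t one_pos)
    (Eventually.of_forall hmeas) hint (hmeas₁ t)
    ((ae_restrict_iff' hK.measurableSet).2 (ae_of_all _ fun p hp s hs ↦ hC s hs p hp))
    (integrable_const C)
    (ae_of_all _ fun p s _ ↦ (hasDerivAt_density (hpb := hpb) (himm := himm) hF t₀ s p).1)
  refine ⟨key.1, ?_⟩
  have hfun : areaOn hpb himm K = fun s ↦ ∫ p in K, density hpb himm t₀ s p ∂μ₀ :=
    funext fun s ↦ areaOn_eq_setIntegral_density t₀ s hK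
  rw [hfun]
  exact key.2

omit [(ofRiemannian h).HasLeviCivita] in
/-- **Second variation of area, differentiated under the integral sign**: for a compact `K ⊆ S`,
`s ↦ ∫_K ∂ₜ(dμ_s/dμ_{t₀}) dμ_{t₀}` (`= A_K'(s)`, `hasDerivAt_areaOn`) is differentiable at every
`t` with derivative `∫_K ∂ₜ²(dμ_t/dμ_{t₀}) dμ_{t₀}`. Lawson 1980, Ch. I, Thm. 7.2.
[cite: Chavel2006, §III.3 (III.3.5)–(III.3.6)] -/
theorem hasDerivAt_setIntegral_densityDeriv
    (hF : ContMDiff (𝓘(ℝ, ℝ).prod (𝓡 2)) (𝓡 3) ∞ (fun q : ℝ × S ↦ F q.1 q.2)) (t₀ : ℝ)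
    {K : Set S} (hK : IsCompact K) (t : ℝ) :
    Integrable (fun p ↦ densityDeriv₂ hpb himm t₀ t p)
        ((riemannianMeasure (metricAt hpb himm t₀)).restrict K) ∧
      HasDerivAt
        (fun s ↦ ∫ p in K, densityDeriv hpb himm t₀ s p ∂riemannianMeasure (metricAt hpb himm t₀))
        (∫ p in K, densityDeriv₂ hpb himm t₀ t p ∂riemannianMeasure (metricAt hpb himm t₀)) t := by
  set μ₀ := riemannianMeasure (metricAt hpb himm t₀) with hμ₀
  haveI : IsFiniteMeasure (μ₀.restrict K) := by
    refine ⟨?_⟩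
    rw [Measure.restrict_apply_univ]
    exact riemannianMeasure_lt_top_of_isCompact t₀ hK
  obtain ⟨hc₁, hc₂⟩ := continuous_densityDeriv (hpb := hpb) (himm := himm) hF t₀
  obtain ⟨C, hC⟩ := exists_bound_of_continuous hc₂ t hK
  have hmeas₁ : ∀ s, AEStronglyMeasurable (fun p ↦ densityDeriv hpb himm t₀ s p) (μ₀.restrict K) :=
    fun s ↦ (hc₁.comp (continuous_const.prodMk continuous_id)).aestronglyMeasurable
  have hmeas₂ : ∀ s, AEStronglyMeasurable (fun p ↦ densityDeriv₂ hpb himm t₀ s p) (μ₀.restrict K) :=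
    fun s ↦ (hc₂.comp (continuous_const.prodMk continuous_id)).aestronglyMeasurable
  have hint : Integrable (fun p ↦ densityDeriv hpb himm t₀ t p) (μ₀.restrict K) :=
    (hasDerivAt_areaOn (hpb := hpb) (himm := himm) hF t₀ hK t).1
  exact hasDerivAt_integral_of_dominated_loc_of_deriv_le (μ := μ₀.restrict K)
    (F := fun s p ↦ densityDeriv hpb himm t₀ s p) (F' := fun s p ↦ densityDeriv₂ hpb himm t₀ s p)
    (x₀ := t) (bound := fun _ ↦ C) (Metric.ball_mem_nhds t one_pos)
    (Eventually.of_forall hmeas₁) hint (hmeas₂ t)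
    ((ae_restrict_iff' hK.measurableSet).2 (ae_of_all _ fun p hp s hs ↦ hC s hs p hp))
    (integrable_const C)
    (ae_of_all _ fun p s _ ↦ (hasDerivAt_density (hpb := hpb) (himm := himm) hF t₀ s p).2)

end Deriv


/-! ### The first and second variation integrands at `t₀` -/

section Integrands

variable {hpb : contMDiff_pullbackBilin (𝓡 3) X (𝓡 2) S ∞}
  {himm : ∀ t, (ofRiemannian h).IsSpacelikeImmersion (𝓡 2) (F t)} {t₀ : ℝ}

omit [(ofRiemannian h).HasLeviCivita] in
/-- Every tangent plane `T_p S` has an `(F_{t₀}^*h)`-orthonormal basis indexed by `Fin 2`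
(`exists_orthonormal_basis`, reindexed). [folklore] -/
theorem exists_orthonormal_basis_fin_two (hpb : contMDiff_pullbackBilin (𝓡 3) X (𝓡 2) S ∞)
    (hfi : (ofRiemannian h).IsSpacelikeImmersion (𝓡 2) (F t₀)) (p : S) :
    ∃ β : Module.Basis (Fin 2) ℝ (TangentSpace (𝓡 2) p), ∀ i j,
      (ofRiemannian h).val (F t₀ p) (mfderiv (𝓡 2) (𝓡 3) (F t₀) p (β i))
        (mfderiv (𝓡 2) (𝓡 3) (F t₀) p (β j)) = if i = j then 1 else 0 := by
  set gN := (ofRiemannian h).inducedMetric (F t₀) hpb hfi with hgN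
  obtain ⟨e, he⟩ := gN.exists_orthonormal_basis p (isRiemannian_inducedMetric _ _ hpb hfi)
  have hfin : Module.finrank ℝ (TangentSpace (𝓡 2) p) = 2 := by
    show Module.finrank ℝ (EuclideanSpace ℝ (Fin 2)) = 2; simp
  refine ⟨e.reindex (finCongr hfin), fun i j ↦ ?_⟩
  have h1 := he ((finCongr hfin).symm i) ((finCongr hfin).symm j)
  simp only [Module.Basis.reindex_apply, EmbeddingLike.apply_eq_iff_eq] at h1 ⊢
  exact h1

/-- **The first variation of the area element (any variation field).** For a family smooth on
`(a, b) × S`, `t₀ ∈ (a, b)`, `p ∈ S` and an `(F_{t₀}^*h)`-orthonormal basis `β` of `T_p S`, the Gram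
determinant `D(τ) = det h(dF_τ βᵢ, dF_τ βⱼ)` has `D'(t₀) = 2 ∑ᵢ h(D_{βᵢ} E, dF βᵢ)`, `E = ∂ₜF(t₀, ·)`
the variation field: twice the tangential divergence of `E` along `F_{t₀}` (Lawson 1980, Ch. I,
Thm. 7.1; for `E = f ν` this is `2 f H`). [cite: SchoenYauPMT1979, §2 (2.12)–(2.13)] -/
theorem hasDerivAt_det_gram_general {a b : ℝ}
    (hF : ContMDiffOn (𝓘(ℝ, ℝ).prod (𝓡 2)) (𝓡 3) ∞ (fun q : ℝ × S ↦ F q.1 q.2) (Ioo a b ×ˢ univ))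
    (ht₀ : t₀ ∈ Ioo a b) (p : S) (β : Module.Basis (Fin 2) ℝ (TangentSpace (𝓡 2) p))
    (hβ : ∀ i j, (ofRiemannian h).val (F t₀ p) (mfderiv (𝓡 2) (𝓡 3) (F t₀) p (β i))
      (mfderiv (𝓡 2) (𝓡 3) (F t₀) p (β j)) = if i = j then 1 else 0) :
    HasDerivAt (fun τ ↦ (Matrix.of fun i j ↦ (ofRiemannian h).val (F τ p)
        (mfderiv (𝓡 2) (𝓡 3) (F τ) p (β i)) (mfderiv (𝓡 2) (𝓡 3) (F τ) p (β j))).det)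
      (2 * ∑ i, (ofRiemannian h).val (F t₀ p)
        ((ofRiemannian h).normalDerivAlong (F t₀) (tvelocity (𝓡 3) F t₀) p (β i))
        (mfderiv (𝓡 2) (𝓡 3) (F t₀) p (β i))) t₀ := by
  set Pf : Fin 2 → ℝ → E3 := fun i τ ↦ covariantDerivAlong (ofRiemannian h).leviCivita
    (fun s ↦ F τ (curveThrough (𝓡 2) p (β i) s))
    (fun s ↦ tvelocity (𝓡 3) F τ (curveThrough (𝓡 2) p (β i) s)) 0 with hPf
  set G : ℝ → Fin 2 → Fin 2 → ℝ := fun τ i j ↦ (ofRiemannian h).val (F τ p)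
    (mfderiv (𝓡 2) (𝓡 3) (F τ) p (β i)) (mfderiv (𝓡 2) (𝓡 3) (F τ) p (β j)) with hGdef
  set G₁ : ℝ → Fin 2 → Fin 2 → ℝ := fun τ i j ↦
    (ofRiemannian h).val (F τ p) (Pf i τ) (mfderiv (𝓡 2) (𝓡 3) (F τ) p (β j)) +
      (ofRiemannian h).val (F τ p) (mfderiv (𝓡 2) (𝓡 3) (F τ) p (β i)) (Pf j τ) with hG₁def
  have hGd : ∀ i j, HasDerivAt (fun τ ↦ G τ i j) (G₁ t₀ i j) t₀ :=
    fun i j ↦ hasDerivAt_val_mfderiv hF ht₀ p (β i) (β j)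
  have hdet := hasDerivAt_det_fin_two (G := fun τ ↦ Matrix.of (G τ)) (G' := Matrix.of (G₁ t₀))
    (t := t₀) (fun i j ↦ by simpa only [Matrix.of_apply] using hGd i j)
  have hdet' : HasDerivAt (fun τ ↦ (Matrix.of (G τ)).det)
      (G₁ t₀ 0 0 * G t₀ 1 1 + G t₀ 0 0 * G₁ t₀ 1 1 - (G₁ t₀ 0 1 * G t₀ 1 0 + G t₀ 0 1 * G₁ t₀ 1 0))
      t₀ := by simpa only [Matrix.of_apply] using hdet
  refine hdet'.congr_deriv ?_
  have hG00 : G t₀ 0 0 = 1 := by simp only [hGdef]; rw [hβ]; simp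
  have hG11 : G t₀ 1 1 = 1 := by simp only [hGdef]; rw [hβ]; simp
  have hG01 : G t₀ 0 1 = 0 := by simp only [hGdef]; rw [hβ]; simp
  have hG10 : G t₀ 1 0 = 0 := by simp only [hGdef]; rw [hβ]; simp
  have hsy : ∀ i, (ofRiemannian h).val (F t₀ p) (mfderiv (𝓡 2) (𝓡 3) (F t₀) p (β i)) (Pf i t₀) =
      (ofRiemannian h).val (F t₀ p) (Pf i t₀) (mfderiv (𝓡 2) (𝓡 3) (F t₀) p (β i)) := fun i ↦
    (ofRiemannian h).symm (F t₀ p) _ _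
  rw [hG00, hG11, hG01, hG10]
  simp only [hG₁def, hsy, Fin.sum_univ_two, mul_one, one_mul, mul_zero, zero_mul, add_zero]
  change _ = 2 * ((ofRiemannian h).val (F t₀ p) (Pf 0 t₀) (mfderiv (𝓡 2) (𝓡 3) (F t₀) p (β 0)) +
    (ofRiemannian h).val (F t₀ p) (Pf 1 t₀) (mfderiv (𝓡 2) (𝓡 3) (F t₀) p (β 1)))
  ring

/-- **The first variation integrand**: for the globally smooth family, `p ∈ S` and an
`(F_{t₀}^*h)`-orthonormal basis `β` of `T_p S`,
`∂ₜ(dμ_t/dμ_{t₀})|_{t₀}(p) = ∑ᵢ h(D_{βᵢ} E, dF βᵢ)` with `E = ∂ₜF(t₀, ·)` — the tangential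
divergence of the variation field (Lawson 1980, Ch. I, Thm. 7.1, first variation formula,
pointwise). [cite: SchoenYauPMT1979, §2 (2.12)–(2.13)] -/
theorem densityDeriv_eq_of_orthonormal
    (hF : ContMDiff (𝓘(ℝ, ℝ).prod (𝓡 2)) (𝓡 3) ∞ (fun q : ℝ × S ↦ F q.1 q.2)) (t₀ : ℝ) (p : S)
    (β : Module.Basis (Fin 2) ℝ (TangentSpace (𝓡 2) p))
    (hβ : ∀ i j, (ofRiemannian h).val (F t₀ p) (mfderiv (𝓡 2) (𝓡 3) (F t₀) p (β i))
      (mfderiv (𝓡 2) (𝓡 3) (F t₀) p (β j)) = if i = j then 1 else 0) :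
    densityDeriv hpb himm t₀ t₀ p =
      ∑ i, (ofRiemannian h).val (F t₀ p)
        ((ofRiemannian h).normalDerivAlong (F t₀) (tvelocity (𝓡 3) F t₀) p (β i))
        (mfderiv (𝓡 2) (𝓡 3) (F t₀) p (β i)) := by
  classical
  have ht₀ : t₀ ∈ Ioo (t₀ - 1) (t₀ + 1) := ⟨by linarith, by linarith⟩
  have hD := hasDerivAt_det_gram_general (hF.contMDiffOn (s := Ioo (t₀ - 1) (t₀ + 1) ×ˢ univ))
    ht₀ p β hβ
  have hfun : (fun s ↦ density hpb himm t₀ s p) = fun s ↦ Real.sqrt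
      ((Matrix.of fun i j ↦ (ofRiemannian h).val (F s p) (mfderiv (𝓡 2) (𝓡 3) (F s) p (β i))
        (mfderiv (𝓡 2) (𝓡 3) (F s) p (β j))).det) :=
    funext fun s ↦ density_eq_sqrt_of_orthonormal t₀ s p β hβ
  have h1 : (Matrix.of fun i j ↦ (ofRiemannian h).val (F t₀ p)
      (mfderiv (𝓡 2) (𝓡 3) (F t₀) p (β i)) (mfderiv (𝓡 2) (𝓡 3) (F t₀) p (β j))).det = 1 := by
    rw [Matrix.det_fin_two]
    simp only [Matrix.of_apply]
    rw [hβ 0 0, hβ 1 1, hβ 0 1, hβ 1 0]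
    norm_num
  have hsqrt := hD.sqrt (by rw [h1]; exact one_ne_zero)
  rw [h1, Real.sqrt_one] at hsqrt
  rw [densityDeriv, hfun, hsqrt.deriv]
  ring

/-- **The first variation integrand for a normal variation field**: if `∂ₜF(t₀, ·) = f ν` for a
smooth unit normal `ν` along `F_{t₀}`, then `∂ₜ(dμ_t/dμ_{t₀})|_{t₀} = f H` (Huisken–Polden 1999,
Thm. 3.2 (ii), `∂ₜ dμ = -f H dμ` with the opposite orientation of `ν`; Huisken–Ilmanen 2001,
(1.1) for `f = H⁻¹`). [cite: SchoenYauPMT1979, §2 (2.12)–(2.13)] -/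
theorem densityDeriv_eq_of_normal
    (hF : ContMDiff (𝓘(ℝ, ℝ).prod (𝓡 2)) (𝓡 3) ∞ (fun q : ℝ × S ↦ F q.1 q.2)) (t₀ : ℝ)
    {ν : NormalField (𝓡 3) (F t₀)} {f : S → ℝ}
    (hν : ContMDiff (𝓡 2) (𝓡 3).tangent ∞
      (fun y ↦ (TotalSpace.mk' E3 (F t₀ y) (ν y) : TangentBundle (𝓡 3) X)))
    (hun : (ofRiemannian h).IsUnitNormal (𝓡 2) (F t₀) ν 1)
    (hf : ContMDiff (𝓡 2) 𝓘(ℝ, ℝ) 1 f) (hvel : ∀ y, tvelocity (𝓡 3) F t₀ y = f y • ν y) (p : S) :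
    densityDeriv hpb himm t₀ t₀ p = f p * (ofRiemannian h).meanCurvature (F t₀) hpb (himm t₀) ν p := by
  obtain ⟨β, hβ⟩ := exists_orthonormal_basis_fin_two hpb (himm t₀) p
  rw [densityDeriv_eq_of_orthonormal hF t₀ p β hβ, meanCurvature_eq_of_orthonormal (hpb := hpb)
    (himm t₀) hβ ν, Fin.sum_univ_two]
  have hK : ∀ i, (ofRiemannian h).val (F t₀ p)
      ((ofRiemannian h).normalDerivAlong (F t₀) (tvelocity (𝓡 3) F t₀) p (β i))
      (mfderiv (𝓡 2) (𝓡 3) (F t₀) p (β i)) =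
      f p * (ofRiemannian h).secondFundamentalForm (𝓡 2) (F t₀) ν p (β i) (β i) :=
    fun i ↦ val_P_mfderiv_eq hν hun hf hvel p (β i) (β i)
  rw [hK 0, hK 1]
  ring

set_option maxHeartbeats 400000 in
/-- **The second variation integrand for a normal variation field** (Lawson 1980, Ch. I,
Thm. 7.2, pointwise; Schoen–Yau 1979, (2.13) before integration). For the globally smooth family
of immersions with `∂ₜF(t₀, ·) = f ν` (`ν` a smooth unit normal along `F_{t₀}`, `f ∈ C¹`), `p ∈ S`
and an `(F_{t₀}^*h)`-orthonormal basis `β` of `T_p S`: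
`∂ₜ²(dμ_t/dμ_{t₀})|_{t₀}(p) = ‖∇f‖² − f²‖A‖² + f²H² − f² Ric(ν,ν) + ∑ᵢ h(D_{βᵢ} a, dF βᵢ)`, where
`a = D_t ∂ₜF(t₀, ·)` is the acceleration field (`SurfaceVariation.hasDerivAt_det_gram` and
`J = √D`, `J'' = D''/2 − (D')²/4` at `D = 1`). [cite: SchoenYauPMT1979, §2 (2.13), p. 53] -/
theorem densityDeriv₂_eq_of_normal
    (hF : ContMDiff (𝓘(ℝ, ℝ).prod (𝓡 2)) (𝓡 3) ∞ (fun q : ℝ × S ↦ F q.1 q.2)) (t₀ : ℝ)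
    {ν : NormalField (𝓡 3) (F t₀)} {f : S → ℝ}
    (hν : ContMDiff (𝓡 2) (𝓡 3).tangent ∞
      (fun y ↦ (TotalSpace.mk' E3 (F t₀ y) (ν y) : TangentBundle (𝓡 3) X)))
    (hun : (ofRiemannian h).IsUnitNormal (𝓡 2) (F t₀) ν 1)
    (hf : ContMDiff (𝓡 2) 𝓘(ℝ, ℝ) 1 f) (hvel : ∀ y, tvelocity (𝓡 3) F t₀ y = f y • ν y) (p : S)
    (β : Module.Basis (Fin 2) ℝ (TangentSpace (𝓡 2) p))
    (hβ : ∀ i j, (ofRiemannian h).val (F t₀ p) (mfderiv (𝓡 2) (𝓡 3) (F t₀) p (β i))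
      (mfderiv (𝓡 2) (𝓡 3) (F t₀) p (β j)) = if i = j then 1 else 0) :
    densityDeriv₂ hpb himm t₀ t₀ p =
      ((ofRiemannian h).inducedMetric (F t₀) hpb (himm t₀)).gradSq f p
        - f p ^ 2 * ((ofRiemannian h).inducedMetric (F t₀) hpb (himm t₀)).normSq p
            ((ofRiemannian h).secondFundamentalForm (𝓡 2) (F t₀) ν p)
        + f p ^ 2 * (ofRiemannian h).meanCurvature (F t₀) hpb (himm t₀) ν p ^ 2
        - f p ^ 2 * (ofRiemannian h).ricci (F t₀ p) (ν p) (ν p)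
        + ∑ i, (ofRiemannian h).val (F t₀ p)
            ((ofRiemannian h).normalDerivAlong (F t₀)
              (acceleration (𝓡 3) (ofRiemannian h).leviCivita F t₀) p (β i))
            (mfderiv (𝓡 2) (𝓡 3) (F t₀) p (β i)) := by
  classical
  have ht₀ : t₀ ∈ Ioo (t₀ - 1) (t₀ + 1) := ⟨by linarith, by linarith⟩
  obtain ⟨D₁, hD, hD0, hD₁0, hD₂⟩ := hasDerivAt_det_gram
    (hF.contMDiffOn (s := Ioo (t₀ - 1) (t₀ + 1) ×ˢ univ)) (himm t₀) ht₀ hν hun hf hvel p β hβ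
  set D : ℝ → ℝ := fun τ ↦ (Matrix.of fun i j ↦ (ofRiemannian h).val (F τ p)
    (mfderiv (𝓡 2) (𝓡 3) (F τ) p (β i)) (mfderiv (𝓡 2) (𝓡 3) (F τ) p (β j))).det with hDdef
  have hDpos : ∀ τ, 0 < D τ := fun τ ↦ det_gram_pos' hpb himm τ p β
  -- `density (·) p = √D` and its first derivative on the interval
  have hfun : (fun s ↦ density hpb himm t₀ s p) = fun s ↦ Real.sqrt (D s) :=
    funext fun s ↦ density_eq_sqrt_of_orthonormal t₀ s p β hβ
  have hderiv₁ : ∀ τ ∈ Ioo (t₀ - 1) (t₀ + 1),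
      HasDerivAt (fun s ↦ density hpb himm t₀ s p) (D₁ τ / (2 * Real.sqrt (D τ))) τ := by
    intro τ hτ
    rw [hfun]
    exact (hD τ hτ).sqrt (hDpos τ).ne'
  have hev : (fun s ↦ densityDeriv hpb himm t₀ s p) =ᶠ[𝓝 t₀]
      fun s ↦ D₁ s / (2 * Real.sqrt (D s)) := by
    filter_upwards [isOpen_Ioo.mem_nhds ht₀] with τ hτ
    exact (hderiv₁ τ hτ).deriv
  -- differentiate `D₁ / (2 √D)` at `t₀`
  have hsqrt0 : HasDerivAt (fun s ↦ 2 * Real.sqrt (D s)) (2 * (D₁ t₀ / (2 * Real.sqrt (D t₀)))) t₀ :=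
    ((hD t₀ ht₀).sqrt (hDpos t₀).ne').const_mul 2
  have hD0' : D t₀ = 1 := hD0
  have hquot : HasDerivAt (fun s ↦ D₁ s / (2 * Real.sqrt (D s))) _ t₀ :=
    hD₂.div hsqrt0 (by rw [hD0', Real.sqrt_one]; norm_num)
  rw [densityDeriv₂, hev.deriv_eq, hquot.deriv, hD0', Real.sqrt_one, hD₁0]
  field_simp
  ring

end Integrands

end SurfaceVariation

end Literature.Geometry.Lorentzian

end
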